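import Summits.ResolutionOfSingularities.ResolutionOfSingularities.Theorems.FrobeniusLadderFInjectiveMacaulayficationGradedDomainChartClause
import Summits.ResolutionOfSingularities.ResolutionOfSingularities.Theorems.FrobeniusLadderFInjectiveMacaulayficationGradedDomainConeCore
import HarnessLib

/-!
# G5ᵍ `stub_gradedDomainConeFiModel`: THE GRADED ENGINE FOR A POSITIVELY GRADED AFFINE DOMAIN (crux `FInjectiveMacaulayfication`, line H4-gd)

Proof file for the (H4-gd) stub `stub_gradedDomainConeFiModel` of crux stmt-ResolutionOfSingularities-15315
(`FrobeniusLadder.FInjectiveMacaulayfication`): statement VERBATIM from res-L1-w45a-plan-1's `L/w45a/Stubs-v19.lean`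
(sha16 fe36a58e936a452f, §3; CRUX-PLAN w45a v7 R7.4/R7.6, registered in skeleton v19 by res-L1-w45a-lead-1). Seat
res-L1-w45a-stub-2. [OURS · L1 W4.5a] AI-written; AI review is weaker than expert review. No statement of Hironaka2017 is used;
no external fact is consumed.

For `w` positive weights with `N = c_v · w_v` for every `v`, Veronese saturation of `I_N = (x^b : w·b ≥ N)`, `G` a set of
`w`-weighted-homogeneous polynomials generating a PRIME ideal with all `x̄_v ≠ 0` in `R = k[X]/(G)`: if `R` satisfies the clause
at every maximal ideal missing some `x̄_j` (off the vertex), then the weighted blow-up `affineBlowup (I_N R)` is an F-injective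
Macaulayfication of `Spec R` — at EVERY prime `p`, in ANY embedding codimension (G5 `GradedConeFiModel.stub_gradedConeFiModel`,
p488729, is the hypersurface case `G = {f}`). Proof: the engine core for graded domains
`GradedDomainConeCore.gradedDomainConeFiModel_of_chartClause` needs only the chart clause at the maximal ideals of each chart
`R[I_N R/x̄_v^{c_v}]` containing `x̄_v^{c_v}`, which is G4ᵍ `GradedDomainChartClause.gradedDomainChartClause_X_pow`.
No definitions, no named facts. [folklore shape: cone over an F-injective CM base]
-/

set_option linter.dupNamespace false

open AlgebraicGeometry CategoryTheory Literature.AlgebraicGeometry.Resolution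

namespace Summit.ResolutionOfSingularities.ResolutionOfSingularities.Theorems.FInjectiveMacaulayfication.GradedDomainConeFiModel

open Summit.ResolutionOfSingularities.ResolutionOfSingularities.Theorems.FInjectiveMacaulayfication

/-- **(H4-gd) `stub_gradedDomainConeFiModel` = G5ᵍ** [OURS · L1 W4.5a; registered engine stub, Stubs-v19 §3 verbatim]: `w` positive
weights with a common multiple `N = c_v · w_v`, Veronese saturation of the monomial ideal `I_N = (x^b : w·b ≥ N)`, `I = (G)` a
PRIME ideal generated by `w`-weighted-homogeneous polynomials with all `x̄_v ≠ 0` in `R = k[X]/I`; if `R` satisfies the clause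
at every maximal ideal missing some `x̄_j` (off the vertex), then `Spec R` has a proper birational model with the crux clause at
EVERY point (the weighted blow-up `Bl_(I_N R)`, covered by the charts `R[I_N R/x̄_v^(c_v)]`; engine core
`GradedDomainConeCore.gradedDomainConeFiModel_of_chartClause` ∘ G4ᵍ `GradedDomainChartClause.gradedDomainChartClause_X_pow`).
[folklore shape: cone over an F-injective CM base] -/
theorem stub_gradedDomainConeFiModel : ∀ (p : ℕ) [Fact p.Prime] (k : Type) [Field k] [CharP k p] (n : ℕ) (w : Fin n → ℕ) (N : ℕ)
    (c : Fin n → ℕ), 0 < N → (∀ v : Fin n, 0 < w v ∧ c v * w v = N) →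
    (∀ (K : ℕ) (b : Fin n →₀ ℕ), K * N ≤ Finsupp.weight w b → (MvPolynomial.monomial b (1 : k) : MvPolynomial (Fin n) k) ∈
      (Ideal.span {m : MvPolynomial (Fin n) k | ∃ b : Fin n →₀ ℕ, N ≤ Finsupp.weight w b ∧ m = MvPolynomial.monomial b 1}) ^ K) →
    ∀ (G : Set (MvPolynomial (Fin n) k)), (∀ g ∈ G, ∃ D : ℕ, MvPolynomial.IsWeightedHomogeneous w g D) →
    (Ideal.span G).IsPrime →
    (∀ v : Fin n, Ideal.Quotient.mk (Ideal.span G) (MvPolynomial.X v) ≠ 0) →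
    (∀ (Q : Ideal (MvPolynomial (Fin n) k ⧸ Ideal.span G)) [Q.IsMaximal],
      (∃ j : Fin n, Ideal.Quotient.mk (Ideal.span G) (MvPolynomial.X j) ∉ Q) →
      ∀ d : ℕ, ringKrullDim (Localization.AtPrime Q) = d → ∀ s : Fin d → Localization.AtPrime Q,
        (Ideal.span (Set.range s)).radical.IsMaximal →
          RingTheory.Sequence.IsWeaklyRegular (Localization.AtPrime Q) (List.ofFn s) ∧
          ∀ y : Localization.AtPrime Q, (∃ e : ℕ, y ^ p ^ e ∈ Ideal.span
            ((fun z : Localization.AtPrime Q => z ^ p ^ e) ''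
              (Ideal.span (Set.range s) : Set (Localization.AtPrime Q)))) → y ∈ Ideal.span (Set.range s)) →
    ∃ (X' : Scheme.{0}) (π : X' ⟶ Spec (.of (MvPolynomial (Fin n) k ⧸ Ideal.span G))), IsProper π ∧
      Literature.AlgebraicGeometry.Resolution.IsBirational π ∧
      ∀ y : X', IsDomain (X'.presheaf.stalk y) ∧ ∀ d : ℕ, ringKrullDim (X'.presheaf.stalk y) = d →
        ∀ s : Fin d → X'.presheaf.stalk y, (Ideal.span (Set.range s)).radical.IsMaximal →
          RingTheory.Sequence.IsWeaklyRegular (X'.presheaf.stalk y) (List.ofFn s) ∧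
          ∀ z : X'.presheaf.stalk y, (∃ e : ℕ, z ^ p ^ e ∈
              Ideal.span ((fun w : X'.presheaf.stalk y => w ^ p ^ e) ''
                (Ideal.span (Set.range s) : Set (X'.presheaf.stalk y)))) →
            z ∈ Ideal.span (Set.range s) := by
  intro p _ k _ _ n w N c hN hwc hpow G hG hGprime hXne hoff
  have hc : ∀ j : Fin n, 0 < c j := fun j => Nat.pos_of_ne_zero fun h => by
    have h2 := (hwc j).2
    rw [h, zero_mul] at h2
    omega
  exact GradedDomainConeCore.gradedDomainConeFiModel_of_chartClause p k n w N c hN hwc hpow (Ideal.span G) hGprime hXne hoff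
    (fun v Q _ hQ => GradedDomainChartClause.gradedDomainChartClause_X_pow p k n w v (hwc v).1 N (c v) (hwc v).2 (hc v) hpow
      (Ideal.span G) G rfl hG hGprime (hXne v) hoff Q hQ)

end Summit.ResolutionOfSingularities.ResolutionOfSingularities.Theorems.FInjectiveMacaulayfication.GradedDomainConeFiModel
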